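import Mathlib
import Literature.Barriers.MatrixMultiplication.NormalizerBarrier
import Literature.RepresentationTheory.FiniteGroups.CharacterDegrees
import Summits.MatrixMultiplication.MatrixMultiplication.Theorems.LieRankDesigns.Negative.Basics
import Summits.MatrixMultiplication.MatrixMultiplication.Theorems.SubgroupIdentityDesigns.Negative.BlockSliceTypes
import Summits.MatrixMultiplication.MatrixMultiplication.Theorems.SubgroupIdentityDesigns.Negative.BlockSliceNoGo
import Summits.MatrixMultiplication.MatrixMultiplication.Theorems.SubgroupIdentityDesigns.Negative.BlockSliceConditional
import Summits.MatrixMultiplication.MatrixMultiplication.Theorems.SubgroupIdentityDesigns.Negative.BlockSliceBudgetOne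

/-!
# Block slices, VII: two-sided translates `x S y ∋ 1` are conjugates (BLOCK-SLICES Lemma 1.1 (a),(d))
# — the no-go theorems for product sets in ANY translate of a block slice

Supports stmt-MatrixMultiplication-14079 (route `LevelGradedCohnUmans`).  VALUE = theorem, NOT summit
progress.  The no-go theorems `BlockSliceConditional.not_budget_lt_of_slice_eps` (general `k`,
given Lemma 2.1) and `BlockSliceBudgetOne.no_slice_witness_one` (`k = 1`, unconditional) were stated
for subgroup-TPP triples whose products lie in a CONJUGATE `z S z⁻¹` of the block slice
`S = S_{k+l,k} = {g : D(g) = 1}`.  A product set `H₁H₂H₃` contains `1`, and the natural charts are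
the two-sided translates `x S y`; BLOCK-SLICES Lemma 1.1(d) ("translates containing `1` are
conjugates", paper-grade until now) closes the gap.  Here it is proved by pure block algebra:

* `shear C = (1 0; C 1)` and **Lemma 1.1(a)** `factor_slice`: `s ∈ S ⇒ s · shear(−C(s)) ∈ P`,
  `P = {C = 0, D = 1}` (so `S = P · Q`, `Q = {shear C}`);
* `P` is closed under inverses (`par_inv`), `P · S ⊆ S` (`Dblk_par_mul`), `S · Q ⊆ S`
  (`Dblk_mul_shear`);
* **Lemma 1.1(d)** `translate_to_conj`: if `1 ∈ x S y` then `x S y ⊆ z S z⁻¹` with the explicit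
  `z = y⁻¹ · shear(−C(x⁻¹y⁻¹))`; `translate_to_conj_fin` is the same in `GL (Fin (k+l)) F` coordinates
  (lower-right `l × l` block, via `BlockSliceNoGo.toSum`);
* `not_budget_lt_of_translate_eps` (general `k ≥ 1`, `l ≥ 3`, given the Lemma-2.1 character) and
  `no_translate_witness_one` (`k = 1`, `l ≥ 3`, UNCONDITIONAL): the crux inequality
  `∑ᶠ (ψ 1).re^{2+ε} < V^{(2+ε)/3}` fails for every subgroup-TPP triple of `GL_{k+l}(𝔽_p)` whose
  product set lies in ANY two-sided translate `x S y` of the slice, every `ε > 0`.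
-/

set_option linter.dupNamespace false

open scoped BigOperators Matrix
open Literature.Barriers.MatrixMultiplication (SubgroupTPP)
open Literature.RepresentationTheory.FiniteGroups
open Summit.MatrixMultiplication.MatrixMultiplication.Theorems.LieRankDesigns.Negative
  (GLm Mat levelSet)

namespace Summit.MatrixMultiplication.MatrixMultiplication.Theorems.SubgroupIdentityDesigns.Negative
namespace BlockSliceTranslate

open BlockSliceTypes (Ablk Bblk Cblk Dblk Ablk_mul Bblk_mul Cblk_mul Dblk_mul Ablk_one Bblk_one
  Cblk_one Dblk_one)
open BlockSliceNoGo (toSum toSumHom Dblk_toSum)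
open BlockSliceConditional (not_budget_lt_of_slice_eps)
open BlockSliceBudgetOne (no_slice_witness_one)

/-! ## Lemma 1.1(a): `S = P · Q` -/

section Algebra

variable {F : Type*} [Field F] {k l : ℕ}

/-- The lower shear `(1 0; C 1) ∈ GL (Fin k ⊕ Fin l) F`. -/
def shear (C : Matrix (Fin l) (Fin k) F) : GL (Fin k ⊕ Fin l) F where
  val := Matrix.fromBlocks 1 0 C 1
  inv := Matrix.fromBlocks 1 0 (-C) 1
  val_inv := by rw [Matrix.fromBlocks_multiply]; simp
  inv_val := by rw [Matrix.fromBlocks_multiply]; simp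

/-- `A(shear C) = 1`. -/
@[simp] theorem Ablk_shear (C : Matrix (Fin l) (Fin k) F) : Ablk (shear C) = 1 := by
  show (Matrix.fromBlocks 1 0 C 1 : Matrix _ _ F).toBlocks₁₁ = 1
  exact Matrix.toBlocks_fromBlocks₁₁ 1 0 C 1

/-- `B(shear C) = 0`. -/
@[simp] theorem Bblk_shear (C : Matrix (Fin l) (Fin k) F) : Bblk (shear C) = 0 := by
  show (Matrix.fromBlocks 1 0 C 1 : Matrix _ _ F).toBlocks₁₂ = 0
  exact Matrix.toBlocks_fromBlocks₁₂ 1 0 C 1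

/-- `C(shear C) = C`. -/
@[simp] theorem Cblk_shear (C : Matrix (Fin l) (Fin k) F) : Cblk (shear C) = C := by
  show (Matrix.fromBlocks 1 0 C 1 : Matrix _ _ F).toBlocks₂₁ = C
  exact Matrix.toBlocks_fromBlocks₂₁ 1 0 C 1

/-- `D(shear C) = 1`. -/
@[simp] theorem Dblk_shear (C : Matrix (Fin l) (Fin k) F) : Dblk (shear C) = 1 := by
  show (Matrix.fromBlocks 1 0 C 1 : Matrix _ _ F).toBlocks₂₂ = 1
  exact Matrix.toBlocks_fromBlocks₂₂ 1 0 C 1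

/-- `S · Q ⊆ S`: right multiplication by a shear keeps the lower-right block `= 1`. -/
theorem Dblk_mul_shear {s : GL (Fin k ⊕ Fin l) F} (hs : Dblk s = 1) (C : Matrix (Fin l) (Fin k) F) :
    Dblk (s * shear C) = 1 := by
  rw [Dblk_mul, Bblk_shear, Dblk_shear, hs, Matrix.mul_zero, Matrix.mul_one, zero_add]

/-- `P · S ⊆ S`: left multiplication by `h ∈ P = {C = 0, D = 1}` keeps the lower-right block `= 1`. -/
theorem Dblk_par_mul {h s : GL (Fin k ⊕ Fin l) F} (hC : Cblk h = 0) (hD : Dblk h = 1)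
    (hs : Dblk s = 1) : Dblk (h * s) = 1 := by
  rw [Dblk_mul, hC, hD, hs, Matrix.zero_mul, Matrix.mul_one, zero_add]

/-- `P` is closed under inverses (read off from `h h⁻¹ = 1` blockwise; no determinant needed). -/
theorem par_inv {h : GL (Fin k ⊕ Fin l) F} (hC : Cblk h = 0) (hD : Dblk h = 1) :
    Cblk h⁻¹ = 0 ∧ Dblk h⁻¹ = 1 := by
  have h₁ := Cblk_mul h h⁻¹
  rw [mul_inv_cancel, Cblk_one, hC, hD, Matrix.zero_mul, Matrix.one_mul, zero_add] at h₁
  have h₂ := Dblk_mul h h⁻¹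
  rw [mul_inv_cancel, Dblk_one, hC, hD, Matrix.zero_mul, Matrix.one_mul, zero_add] at h₂
  exact ⟨h₁.symm, h₂.symm⟩

/-- **Lemma 1.1(a)**: for `s ∈ S`, `h := s · shear(−C(s))` lies in `P` (`C(h) = 0`, `D(h) = 1`), i.e.
`s = h · shear(C(s))` with `h = (A − BC, B; 0, 1)`. -/
theorem factor_slice {s : GL (Fin k ⊕ Fin l) F} (hs : Dblk s = 1) :
    Cblk (s * shear (-Cblk s)) = 0 ∧ Dblk (s * shear (-Cblk s)) = 1 := by
  refine ⟨?_, Dblk_mul_shear hs _⟩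
  rw [Cblk_mul, Ablk_shear, Cblk_shear, hs, Matrix.mul_one, Matrix.one_mul, add_neg_cancel]

/-! ## Lemma 1.1(d): a translate `x S y ∋ 1` lies in a conjugate `z S z⁻¹` -/

/-- **Lemma 1.1(d).**  If `1 ∈ x S y` (i.e. `D(x⁻¹y⁻¹) = 1`) then `x S y ⊆ z S z⁻¹` for
`z = y⁻¹ · shear(−C(x⁻¹y⁻¹))`: every `g` with `D(x⁻¹ g y⁻¹) = 1` has `D(z⁻¹ g z) = 1`.
(Proof: `s₀ := x⁻¹y⁻¹ = h q` by (a); `z⁻¹ g z = h⁻¹ (x⁻¹ g y⁻¹) q⁻¹… ∈ P · S · Q = S`.) -/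
theorem translate_to_conj (x y : GL (Fin k ⊕ Fin l) F) (h1 : Dblk (x⁻¹ * y⁻¹) = 1) :
    ∃ z : GL (Fin k ⊕ Fin l) F, ∀ g : GL (Fin k ⊕ Fin l) F,
      Dblk (x⁻¹ * g * y⁻¹) = 1 → Dblk (z⁻¹ * g * z) = 1 := by
  refine ⟨y⁻¹ * shear (-Cblk (x⁻¹ * y⁻¹)), fun g hg => ?_⟩
  obtain ⟨hC, hD⟩ := factor_slice h1
  obtain ⟨hC', hD'⟩ := par_inv hC hD
  have key : (y⁻¹ * shear (-Cblk (x⁻¹ * y⁻¹)))⁻¹ * g * (y⁻¹ * shear (-Cblk (x⁻¹ * y⁻¹))) =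
      (x⁻¹ * y⁻¹ * shear (-Cblk (x⁻¹ * y⁻¹)))⁻¹ * (x⁻¹ * g * y⁻¹) *
        shear (-Cblk (x⁻¹ * y⁻¹)) := by
    group
  rw [key]
  exact Dblk_mul_shear (Dblk_par_mul hC' hD' hg) _

/-- Lower-right-block condition in `GL (Fin (k + l)) F` coordinates `↔` `D(toSum g) = 1`. -/
theorem lowerRight_iff (g : GL (Fin (k + l)) F) :
    (∀ i j : Fin l, (g : Matrix (Fin (k + l)) (Fin (k + l)) F) (Fin.natAdd k i) (Fin.natAdd k j) =
        (1 : Matrix (Fin l) (Fin l) F) i j) ↔ Dblk (toSumHom g) = 1 := by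
  constructor
  · intro h
    ext i j
    rw [Dblk_toSum]
    exact h i j
  · intro h i j
    rw [← Dblk_toSum, h]

/-- **Lemma 1.1(d) in `GL_{k+l}(F)` coordinates**: if `x⁻¹y⁻¹` has lower-right `l × l` block `1`,
there is `z` such that every `g` with `x⁻¹ g y⁻¹` in the slice has `z⁻¹ g z` in the slice. -/
theorem translate_to_conj_fin (x y : GL (Fin (k + l)) F)
    (h1 : ∀ i j : Fin l, ((x⁻¹ * y⁻¹ : GL (Fin (k + l)) F) : Matrix (Fin (k + l)) (Fin (k + l)) F)
      (Fin.natAdd k i) (Fin.natAdd k j) = (1 : Matrix (Fin l) (Fin l) F) i j) :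
    ∃ z : GL (Fin (k + l)) F, ∀ g : GL (Fin (k + l)) F,
      (∀ i j : Fin l, ((x⁻¹ * g * y⁻¹ : GL (Fin (k + l)) F) : Matrix (Fin (k + l)) (Fin (k + l)) F)
          (Fin.natAdd k i) (Fin.natAdd k j) = (1 : Matrix (Fin l) (Fin l) F) i j) →
      ∀ i j : Fin l, ((z⁻¹ * g * z : GL (Fin (k + l)) F) : Matrix (Fin (k + l)) (Fin (k + l)) F)
          (Fin.natAdd k i) (Fin.natAdd k j) = (1 : Matrix (Fin l) (Fin l) F) i j := by
  have h1' : Dblk ((toSumHom x)⁻¹ * (toSumHom y)⁻¹) = 1 := by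
    rw [← map_inv, ← map_inv, ← map_mul]
    exact (lowerRight_iff _).1 h1
  obtain ⟨z', hz'⟩ := translate_to_conj (toSumHom x) (toSumHom y) h1'
  refine ⟨toSum.symm z', fun g hg => (lowerRight_iff _).2 ?_⟩
  have hg' : Dblk ((toSumHom x)⁻¹ * toSumHom g * (toSumHom y)⁻¹) = 1 := by
    rw [← map_inv, ← map_inv, ← map_mul, ← map_mul]
    exact (lowerRight_iff _).1 hg
  have hz := hz' (toSumHom g) hg'
  have hzz : toSumHom (F := F) (k := k) (l := l) (toSum.symm z') = z' := by simp [toSumHom]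
  rwa [map_mul, map_mul, map_inv, hzz]

end Algebra

/-! ## The no-go theorems for arbitrary translates -/

variable {p : ℕ} [Fact p.Prime] {k l : ℕ}

/-- **Conditional no-go on every translate (general `k`).**  `k ≥ 1`, `l ≥ 3`; grant the Lemma-2.1
character `χ ∈ Irr ∩ F_k` with `(χ 1).re ≥ p^{kl+k(k-1)/2}`.  Then for every subgroup-TPP triple of
`GL_{k+l}(𝔽_p)` whose products all lie in a two-sided translate `x S y` of the block slice, and every
`ε > 0`, the crux inequality fails. -/
theorem not_budget_lt_of_translate_eps (hk : 1 ≤ k) (hl : 3 ≤ l) {χ : GLm p (k + l) → ℂ}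
    (hχ : χ ∈ irrChars (GLm p (k + l)) ∩ levelSet p (k + l) k)
    (hχdeg : ((p ^ (k * l + k * (k - 1) / 2) : ℕ) : ℝ) ≤ (χ 1).re)
    {H₁ H₂ H₃ : Subgroup (GL (Fin (k + l)) (ZMod p))} (htpp : SubgroupTPP H₁ H₂ H₃)
    (x y : GL (Fin (k + l)) (ZMod p))
    (hS : ∀ a ∈ H₁, ∀ b ∈ H₂, ∀ c ∈ H₃, ∀ i j : Fin l,
      ((x⁻¹ * (a * b * c) * y⁻¹ : GL (Fin (k + l)) (ZMod p)) :
          Matrix (Fin (k + l)) (Fin (k + l)) (ZMod p)) (Fin.natAdd k i) (Fin.natAdd k j) =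
        (1 : Matrix (Fin l) (Fin l) (ZMod p)) i j)
    {ε : ℝ} (hε : 0 < ε) :
    ¬ ((∑ᶠ ψ ∈ irrChars (GLm p (k + l)) ∩ levelSet p (k + l) k, (ψ 1).re ^ (2 + ε)) <
        ((Nat.card H₁ * Nat.card H₂ * Nat.card H₃ : ℕ) : ℝ) ^ ((2 + ε) / 3)) := by
  have h1 := hS 1 H₁.one_mem 1 H₂.one_mem 1 H₃.one_mem
  simp only [mul_one] at h1
  obtain ⟨z, hz⟩ := translate_to_conj_fin x y h1
  exact not_budget_lt_of_slice_eps hk hl hχ hχdeg htpp z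
    (fun a ha b hb c hc => hz _ (hS a ha b hb c hc)) hε

/-- **Unconditional no-go on every translate, `k = 1`.**  For `l ≥ 3`, every `ε > 0`, every
subgroup-TPP triple `H₁, H₂, H₃ ≤ GL_{1+l}(𝔽_p)` whose product set lies in a two-sided translate
`x S_{1+l,1} y` of the slice (lower-right `l × l` block of `x⁻¹ (abc) y⁻¹` equal to `1`) violates the
crux inequality `∑ᶠ_{ψ ∈ Irr ∩ F_1} (ψ 1).re^{2+ε} < (|H₁||H₂||H₃|)^{(2+ε)/3}`. -/
theorem no_translate_witness_one (hl : 3 ≤ l) {H₁ H₂ H₃ : Subgroup (GLm p (1 + l))}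
    (htpp : SubgroupTPP H₁ H₂ H₃) (x y : GLm p (1 + l))
    (hS : ∀ a ∈ H₁, ∀ b ∈ H₂, ∀ c ∈ H₃, ∀ i j : Fin l,
      ((x⁻¹ * (a * b * c) * y⁻¹ : GLm p (1 + l)) : Mat p (1 + l)) (Fin.natAdd 1 i) (Fin.natAdd 1 j) =
        (1 : Matrix (Fin l) (Fin l) (ZMod p)) i j)
    {ε : ℝ} (hε : 0 < ε) :
    ¬ ((∑ᶠ ψ ∈ irrChars (GLm p (1 + l)) ∩ levelSet p (1 + l) 1, (ψ 1).re ^ (2 + ε)) <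
        ((Nat.card H₁ * Nat.card H₂ * Nat.card H₃ : ℕ) : ℝ) ^ ((2 + ε) / 3)) := by
  have h1 := hS 1 H₁.one_mem 1 H₂.one_mem 1 H₃.one_mem
  simp only [mul_one] at h1
  obtain ⟨z, hz⟩ := translate_to_conj_fin x y h1
  exact no_slice_witness_one hl htpp z (fun a ha b hb c hc => hz _ (hS a ha b hb c hc)) hε

end BlockSliceTranslate
end Summit.MatrixMultiplication.MatrixMultiplication.Theorems.SubgroupIdentityDesigns.Negative
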